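import Mathlib
import Summits.NavierStokesRegularity.NavierStokesRegularity.Theorems.WakeRatchetAdmissibleEternalBoundPersistence
import HarnessLib

/-!
# BLOCK ENERGY PERSISTENCE: a vigorous shell needs a backscattering edge within bounded distance
# below it — `UniformBound` for admissible inviscid eternal solutions whose forward (non-backscattering)
# edges are SYNDETIC (support for `WakeRatchet.AdmissibleEternalBound`, stmt-NavierStokesRegularity-23197)

Continuation of `WakeRatchetAdmissibleEternalBoundPersistence` (single-shell energy persistence).  The
same mechanism for a BLOCK of shells `b, …, b+N`: internal backscatter is invisible to the block's
energy, only the bottom edge matters.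

* `blockEnergy_persist` — `Σ_{j≤N}E_{b+j}(σ₀) ≤ Σ_{j≤N}E_{b+j}(σ)·exp(2C_AM/Λ + 2viscCoef(b+N,σ₀))` for
  `σ ≥ σ₀` when `F_{b-1} ≥ 0` after `σ₀` (`hasDerivAt_tail`, `viscCoef_mono_shell`).
* `blockEnergy_le_sq_sum` — `Σ_{j≤N}E_{b+j} ≤ Λ^{-2b}e^{2σ}(Σ_{j≤N}‖W_{b+j}‖)²`.
* `le_of_integral_exp_tail` — `g ≥ A e^{σ₀-s}` on `[σ₀,∞)` with `∫_{σ₀}^{σ₀+L} g ≤ K` forces `A ≤ K`.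
* `norm_le_of_forwardFlux_block` — `‖W_{b+N}(σ₀)‖ ≤ (N+1)Λ^N M exp(C_AM/Λ + viscCoef(b+N,σ₀))`.
* `uniformBound_of_syndeticForwardEdges` (+ crux-shaped form) — an admissible INVISCID eternal solution
  with a non-backscattering edge within distance `G` below every shell is `UniformBound` (constant
  `(G+1)Λ^G M e^{C_AM/Λ}`); `G = 0` is the forward-cascade theorem of the previous file.

Reading for the planner: inviscidly the crux can only fail through energy travelling DOWN the lattice
across unboundedly long stretches of shells; with viscosity, also through the dissipation range.
MODEL lattice ODEs only (Tao 2016 §4, §6.4); nothing here is a statement about the Navier–Stokes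
equations, and no summit or rung is proved by it.
-/

noncomputable section

set_option linter.dupNamespace false

namespace Summit.NavierStokesRegularity.NavierStokesRegularity.Theorems

namespace WakeRatchetPersistenceBlock

open Filter Topology MeasureTheory Set intervalIntegral
open scoped RealInnerProductSpace
open Literature.Analysis.FluidPDE Literature.Analysis.FluidPDE.TaoCascade
open WakeRatchetFedSpike WakeRatchetPersistence

section Block

variable {m : ℕ} {ε₀ νh : ℝ} {α : Fin m → Fin m → Fin m → ℤ × ℤ × ℤ → ℝ} {W : ℤ → ℝ → Em m}

/-- The covariant viscosity coefficient increases with the shell index.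
[cite: Tao2016AveragedNS, §4, the viscous equation displayed before Thm. 4.2, §6.4; cell vocabulary (`viscCoef`)] -/
theorem viscCoef_mono_shell (hε : 0 < ε₀) (hν : 0 ≤ νh) {j k : ℤ} (hjk : j ≤ k) (σ : ℝ) :
    viscCoef ε₀ νh j σ ≤ viscCoef ε₀ νh k σ := by
  unfold viscCoef
  refine mul_le_mul_of_nonneg_left ?_ hν
  refine mul_le_mul_of_nonneg_right ?_ (Real.exp_pos _).le
  refine Real.rpow_le_rpow_of_exponent_le (by linarith) ?_
  have : (j : ℝ) ≤ (k : ℝ) := by exact_mod_cast hjk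
  linarith

/-- **Exponential-tail integration lemma.**  If a continuous `g` dominates `A e^{σ₀ - s}` on
`[σ₀, ∞)` and all its integrals `∫_{σ₀}^{σ₀+L} g` are `≤ K`, then `A ≤ K`. [folklore] -/
theorem le_of_integral_exp_tail {g : ℝ → ℝ} (hg : Continuous g) {A K σ₀ : ℝ}
    (hdom : ∀ s, σ₀ ≤ s → A * Real.exp (σ₀ - s) ≤ g s)
    (hint : ∀ L, 0 ≤ L → ∫ s in σ₀..(σ₀ + L), g s ≤ K) : A ≤ K := by
  have hstep : ∀ L, 0 ≤ L → A * (1 - Real.exp (-L)) ≤ K := by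
    intro L hL
    have h1 : ∫ s in σ₀..(σ₀ + L), A * Real.exp (σ₀ - s) ≤ ∫ s in σ₀..(σ₀ + L), g s :=
      intervalIntegral.integral_mono_on (by linarith)
        ((by fun_prop : Continuous fun s => A * Real.exp (σ₀ - s)).intervalIntegrable _ _)
        (hg.intervalIntegrable _ _) (fun s hs => hdom s hs.1)
    have h3 : ∫ s in σ₀..(σ₀ + L), A * Real.exp (σ₀ - s) = A * (1 - Real.exp (-L)) := by
      have hd : ∀ s, HasDerivAt (fun s => -(A * Real.exp (σ₀ - s))) (A * Real.exp (σ₀ - s)) s := by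
        intro s
        have e1 : HasDerivAt (fun s : ℝ => Real.exp (σ₀ - s)) (Real.exp (σ₀ - s) * (-1 : ℝ)) s :=
          ((hasDerivAt_id s).const_sub σ₀).exp
        exact (e1.const_mul A).neg.congr_deriv (by ring)
      rw [integral_eq_sub_of_hasDerivAt (fun s _ => hd s)
        ((by fun_prop : Continuous fun s => A * Real.exp (σ₀ - s)).intervalIntegrable _ _)]
      simp only [sub_self, Real.exp_zero, show σ₀ - (σ₀ + L) = -L by ring]
      ring
    have := hint L hL
    linarith
  refine le_of_forall_pos_lt_add fun δ hδ => ?_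
  obtain ⟨L, hL, hL0⟩ : ∃ L, Real.exp (-L) * (A + 1) < δ ∧ 0 ≤ L := by
    have hlim : Tendsto (fun L : ℝ => Real.exp (-L) * (A + 1)) atTop (𝓝 (0 * (A + 1))) :=
      Real.tendsto_exp_neg_atTop_nhds_zero.mul_const _
    rw [zero_mul] at hlim
    exact ((hlim.eventually (gt_mem_nhds hδ)).and (eventually_ge_atTop 0)).exists
  have h1 := hstep L hL0
  have he : 0 ≤ Real.exp (-L) := (Real.exp_pos _).le
  have h2 : A * Real.exp (-L) ≤ Real.exp (-L) * (A + 1) := by nlinarith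
  nlinarith

/-- **Block energy persistence.**  The physical energy `B = Σ_{j≤N} E_{b+j}` of a block whose bottom
edge does not backscatter after `σ₀` satisfies `B(σ₀) ≤ B(σ) · exp(2C_A M/Λ + 2·viscCoef(b+N, σ₀))`
for all `σ ≥ σ₀` (top flux paid by the action of shell `b+N+1`, block dissipation at most that of the
top shell, whose budget is finite forward in log-time).
[cite: Tao2016AveragedNS, §4 Lemma 4.1 (4.8)–(4.10) with (4.3), the viscous equation before Thm. 4.2, §6.4; cell vocabulary] -/
theorem blockEnergy_persist (hε : 0 < ε₀) (hc : IsCancellingCoeff α) (hW : IsEternalVisc ε₀ νh α W)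
    {M : ℝ} (hM : ∀ n : ℤ, Integrable (fun σ => ‖W n σ‖) ∧ ∫ σ, ‖W n σ‖ ≤ M)
    (b : ℤ) (N : ℕ) (σ₀ : ℝ) (hF : ∀ σ, σ₀ ≤ σ → 0 ≤ physFlux ε₀ α W (b - 1) σ)
    {σ : ℝ} (hσ : σ₀ ≤ σ) :
    ∑ j ∈ Finset.range (N + 1), physEnergy ε₀ W (b + j) σ₀ ≤
      (∑ j ∈ Finset.range (N + 1), physEnergy ε₀ W (b + j) σ) *
        Real.exp (2 * (fluxConst α * (bigLam ε₀)⁻¹ * M + viscCoef ε₀ νh (b + N) σ₀)) := by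
  have hS := table_sTable α hc
  have hΛpos : 0 < bigLam ε₀ := bigLam_pos (by linarith)
  have hΛi : 0 ≤ (bigLam ε₀)⁻¹ := inv_nonneg.2 hΛpos.le
  have hCA : 0 ≤ fluxConst α := hS.CA_nonneg
  have hWc : ∀ n : ℤ, Continuous (W n) := fun n =>
    continuous_iff_continuousAt.2 fun x => (hW.law n x).continuousAt
  -- the block energy and its derivative (`hasDerivAt_tail` with bottom shell `b = (b-1)+1`)
  have etop : b - 1 + ((N + 1 : ℕ) : ℤ) = b + N := by push_cast; ring
  have eidx : ∀ j : ℕ, b - 1 + 1 + (j : ℤ) = b + j := fun j => by ring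
  set B : ℝ → ℝ := fun x => ∑ j ∈ Finset.range (N + 1), physEnergy ε₀ W (b + j) x
    with hBdef
  set D : ℝ → ℝ := fun σ => physFlux ε₀ α W (b - 1) σ - physFlux ε₀ α W (b + N) σ
      - ∑ j ∈ Finset.range (N + 1),
          2 * viscCoef ε₀ νh (b + j) σ * physEnergy ε₀ W (b + j) σ with hDdef
  have hBd : ∀ σ, HasDerivAt B (D σ) σ := by
    intro σ
    have h := hasDerivAt_tail hε hW hc (b - 1) (N + 1) σ
    simp only [eidx, etop] at h
    exact h
  have hB0 : ∀ σ, 0 ≤ B σ := fun σ =>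
    Finset.sum_nonneg fun j _ => physEnergy_nonneg _ _ _ _
  have hEtop : ∀ σ, physEnergy ε₀ W (b + N) σ ≤ B σ := fun σ =>
    Finset.single_le_sum (s := Finset.range (N + 1))
      (f := fun j : ℕ => physEnergy ε₀ W (b + (j : ℤ)) σ)
      (fun j _ => physEnergy_nonneg _ _ _ _) (Finset.mem_range.2 (Nat.lt_succ_self N))
  -- the loss rate `q = 2C_AΛ⁻¹‖W_{b+N+1}‖ + 2ν̂_{b+N}`
  set q : ℝ → ℝ := fun s => 2 * fluxConst α * (bigLam ε₀)⁻¹ * ‖W (b + N + 1) s‖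
    + 2 * viscCoef ε₀ νh (b + N) s with hqdef
  have hWt := hWc (b + N + 1)
  have hqc : Continuous q := by simp only [hqdef]; unfold viscCoef; fun_prop
  set J : ℝ → ℝ := fun σ => ∫ s in σ₀..σ, q s with hJdef
  have hJd : ∀ σ, HasDerivAt J (q σ) σ := fun σ =>
    intervalIntegral.integral_hasDerivAt_right (hqc.intervalIntegrable _ _)
      (hqc.stronglyMeasurableAtFilter _ _) hqc.continuousAt
  -- `B' ≥ -q B` after `σ₀`
  have hlow : ∀ σ, σ₀ ≤ σ → -(q σ * B σ) ≤ D σ := by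
    intro σ hσ
    have h1 := hF σ hσ
    have h2 : physFlux ε₀ α W (b + N) σ
        ≤ 2 * fluxConst α * (bigLam ε₀)⁻¹ * ‖W (b + N + 1) σ‖ * B σ :=
      calc physFlux ε₀ α W (b + N) σ
          ≤ 2 * fluxConst α * (bigLam ε₀)⁻¹ * ‖W (b + N + 1) σ‖ * physEnergy ε₀ W (b + N) σ :=
            (le_abs_self _).trans (abs_physFlux_le hε hc W (b + N) σ)
        _ ≤ 2 * fluxConst α * (bigLam ε₀)⁻¹ * ‖W (b + N + 1) σ‖ * B σ :=
            mul_le_mul_of_nonneg_left (hEtop σ) (by positivity)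
    have h3 : ∑ j ∈ Finset.range (N + 1),
          2 * viscCoef ε₀ νh (b + j) σ * physEnergy ε₀ W (b + j) σ
        ≤ 2 * viscCoef ε₀ νh (b + N) σ * B σ := by
      simp only [hBdef]
      rw [Finset.mul_sum]
      refine Finset.sum_le_sum fun j hj => ?_
      have hjN : (j : ℤ) ≤ N := by exact_mod_cast Nat.lt_succ_iff.1 (Finset.mem_range.1 hj)
      refine mul_le_mul_of_nonneg_right ?_ (physEnergy_nonneg _ _ _ _)
      refine mul_le_mul_of_nonneg_left ?_ (by norm_num)
      exact viscCoef_mono_shell hε hW.nonneg (by linarith) σ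
    have e : q σ * B σ = 2 * fluxConst α * (bigLam ε₀)⁻¹ * ‖W (b + N + 1) σ‖ * B σ
        + 2 * viscCoef ε₀ νh (b + N) σ * B σ := by simp only [hqdef]; ring
    rw [e]
    simp only [hDdef]
    linarith
  -- `ψ = B · e^{J}` is monotone on `[σ₀, ∞)`
  set ψ : ℝ → ℝ := fun σ => B σ * Real.exp (J σ) with hψdef
  have hψd : ∀ σ, HasDerivAt ψ (D σ * Real.exp (J σ) + B σ * (Real.exp (J σ) * q σ)) σ :=
    fun σ => (hBd σ).mul (hJd σ).exp
  have hψmono : MonotoneOn ψ (Ici σ₀) := by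
    refine monotoneOn_of_deriv_nonneg (convex_Ici σ₀)
      (fun x _ => (hψd x).continuousAt.continuousWithinAt)
      (fun x _ => (hψd x).differentiableAt.differentiableWithinAt) ?_
    intro x hx
    rw [interior_Ici] at hx
    rw [(hψd x).deriv]
    have hl := hlow x (le_of_lt hx)
    have h0 : 0 ≤ D x + q x * B x := by linarith
    have hexp : 0 ≤ Real.exp (J x) := (Real.exp_pos _).le
    calc (0 : ℝ) ≤ (D x + q x * B x) * Real.exp (J x) := mul_nonneg h0 hexp
      _ = _ := by ring
  -- the loss integral is at most `2c`
  have hJle : J σ ≤ 2 * (fluxConst α * (bigLam ε₀)⁻¹ * M + viscCoef ε₀ νh (b + N) σ₀) := by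
    have hsplit : J σ = 2 * fluxConst α * (bigLam ε₀)⁻¹ * (∫ s in σ₀..σ, ‖W (b + N + 1) s‖)
        + ∫ s in σ₀..σ, 2 * viscCoef ε₀ νh (b + N) s := by
      simp only [hJdef, hqdef]
      have c1 : IntervalIntegrable (fun s => 2 * fluxConst α * (bigLam ε₀)⁻¹ * ‖W (b + N + 1) s‖)
          volume σ₀ σ := ((hWc (b + N + 1)).norm.const_mul _).intervalIntegrable _ _
      have c2 : IntervalIntegrable (fun s => 2 * viscCoef ε₀ νh (b + N) s) volume σ₀ σ := by
        refine Continuous.intervalIntegrable ?_ _ _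
        unfold viscCoef; fun_prop
      rw [intervalIntegral.integral_add c1 c2, intervalIntegral.integral_const_mul]
    have hI1 : ∫ s in σ₀..σ, ‖W (b + N + 1) s‖ ≤ M :=
      (intervalIntegral_le_integral (hM (b + N + 1)).1 (fun _ => norm_nonneg _) hσ).trans
        (hM (b + N + 1)).2
    have hI2 := integral_viscCoef_le hε hW.nonneg (b + N) σ₀ σ
    rw [hsplit]
    have : 2 * fluxConst α * (bigLam ε₀)⁻¹ * (∫ s in σ₀..σ, ‖W (b + N + 1) s‖)
        ≤ 2 * fluxConst α * (bigLam ε₀)⁻¹ * M := mul_le_mul_of_nonneg_left hI1 (by positivity)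
    linarith
  have h1 : ψ σ₀ ≤ ψ σ := hψmono self_mem_Ici (mem_Ici.2 hσ) hσ
  have hψ0 : ψ σ₀ = B σ₀ := by
    simp only [hψdef, hJdef, intervalIntegral.integral_same, Real.exp_zero, mul_one]
  rw [hψ0] at h1
  exact h1.trans (mul_le_mul_of_nonneg_left (Real.exp_le_exp.2 hJle) (hB0 σ))

/-- **Block energy versus summed amplitude**: `Σ_{j≤N} E_{b+j}(σ) ≤ Λ^{-2b} e^{2σ} (Σ_{j≤N} ‖W_{b+j}(σ)‖)²`
(all weights `Λ^{-2(b+j)} ≤ Λ^{-2b}`, and `Σ a_j² ≤ (Σ a_j)²` for `a_j ≥ 0`).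
[cite: Tao2016AveragedNS, §4 Lemma 4.1 (4.10) (local energies), §6.4; cell vocabulary (`physEnergy`)] -/
theorem blockEnergy_le_sq_sum (hε : 0 < ε₀) (W : ℤ → ℝ → Em m) (b : ℤ) (N : ℕ) (σ : ℝ) :
    ∑ j ∈ Finset.range (N + 1), physEnergy ε₀ W (b + j) σ ≤
      (bigLam ε₀ ^ b)⁻¹ ^ 2 * Real.exp (2 * σ) *
        (∑ j ∈ Finset.range (N + 1), ‖W (b + j) σ‖) ^ 2 := by
  have hΛpos : 0 < bigLam ε₀ := bigLam_pos (by linarith)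
  have hΛ1 : 1 ≤ bigLam ε₀ := one_le_bigLam hε.le
  have hterm : ∀ j ∈ Finset.range (N + 1), physEnergy ε₀ W (b + j) σ
      ≤ (bigLam ε₀ ^ b)⁻¹ ^ 2 * Real.exp (2 * σ) * ‖W (b + j) σ‖ ^ 2 := by
    intro j _
    unfold physEnergy
    have hw : (bigLam ε₀ ^ (b + (j : ℤ)))⁻¹ ^ 2 ≤ (bigLam ε₀ ^ b)⁻¹ ^ 2 := by
      have h1 : bigLam ε₀ ^ b ≤ bigLam ε₀ ^ (b + (j : ℤ)) :=
        zpow_le_zpow_right₀ hΛ1 (by linarith [Int.natCast_nonneg j])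
      have h2 : 0 < bigLam ε₀ ^ b := zpow_pos hΛpos b
      have h3 : (bigLam ε₀ ^ (b + (j : ℤ)))⁻¹ ≤ (bigLam ε₀ ^ b)⁻¹ := inv_anti₀ h2 h1
      have h4 : 0 ≤ (bigLam ε₀ ^ (b + (j : ℤ)))⁻¹ := inv_nonneg.2 (zpow_pos hΛpos _).le
      exact pow_le_pow_left₀ h4 h3 2
    have h5 : 0 ≤ Real.exp (2 * σ) * ‖W (b + j) σ‖ ^ 2 := by positivity
    calc (bigLam ε₀ ^ (b + (j : ℤ)))⁻¹ ^ 2 * (Real.exp (2 * σ) * ‖W (b + j) σ‖ ^ 2)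
        ≤ (bigLam ε₀ ^ b)⁻¹ ^ 2 * (Real.exp (2 * σ) * ‖W (b + j) σ‖ ^ 2) :=
          mul_le_mul_of_nonneg_right hw h5
      _ = _ := by ring
  have h6 : 0 ≤ (bigLam ε₀ ^ b)⁻¹ ^ 2 * Real.exp (2 * σ) := by
    have := zpow_pos hΛpos b
    positivity
  calc ∑ j ∈ Finset.range (N + 1), physEnergy ε₀ W (b + j) σ
      ≤ ∑ j ∈ Finset.range (N + 1),
        (bigLam ε₀ ^ b)⁻¹ ^ 2 * Real.exp (2 * σ) * ‖W (b + j) σ‖ ^ 2 := Finset.sum_le_sum hterm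
    _ = (bigLam ε₀ ^ b)⁻¹ ^ 2 * Real.exp (2 * σ) *
        ∑ j ∈ Finset.range (N + 1), ‖W (b + j) σ‖ ^ 2 := by rw [Finset.mul_sum]
    _ ≤ (bigLam ε₀ ^ b)⁻¹ ^ 2 * Real.exp (2 * σ) *
        (∑ j ∈ Finset.range (N + 1), ‖W (b + j) σ‖) ^ 2 :=
        mul_le_mul_of_nonneg_left
          (Finset.sum_sq_le_sq_sum_of_nonneg fun j _ => norm_nonneg _) h6

/-- **BLOCK ENERGY PERSISTENCE BOUND.**  On a cancelling table, for an admissible eternal solution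
(any `ν̂ ≥ 0`) with per-shell action `∫‖W_n‖ ≤ M`, every block of shells `b, …, b+N` whose BOTTOM edge
does not backscatter after `σ₀` (`0 ≤ F_{b-1}(σ)` for `σ ≥ σ₀`; backscatter INSIDE the block is
allowed) satisfies, at its top shell,
`‖W_{b+N}(σ₀)‖ ≤ (N+1) Λ^N M · exp(C_A M/Λ + viscCoef(b+N, σ₀))`.
Mechanism: `blockEnergy_persist` + `blockEnergy_le_sq_sum` force
`Σ_j ‖W_{b+j}(σ)‖ ≥ Λ^{-N}‖W_{b+N}(σ₀)‖e^{-(σ-σ₀)}e^{-(C_AM/Λ+viscCoef)}` for `σ ≥ σ₀`, whose time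
integral is at most `(N+1)M`.  MODEL lattice ODEs only; nothing about NS.
[cite: Tao2016AveragedNS, §4 Lemma 4.1 (4.8)–(4.10) with (4.3), the viscous equation before Thm. 4.2, §6.4; cell vocabulary (`IsEternalVisc`, `physEnergy`, `physFlux`)] -/
theorem norm_le_of_forwardFlux_block (hε : 0 < ε₀) (hc : IsCancellingCoeff α)
    (hW : IsEternalVisc ε₀ νh α W)
    {M : ℝ} (hM : ∀ n : ℤ, Integrable (fun σ => ‖W n σ‖) ∧ ∫ σ, ‖W n σ‖ ≤ M)
    (b : ℤ) (N : ℕ) (σ₀ : ℝ) (hF : ∀ σ, σ₀ ≤ σ → 0 ≤ physFlux ε₀ α W (b - 1) σ) :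
    ‖W (b + N) σ₀‖ ≤ (N + 1) * bigLam ε₀ ^ N * M *
      Real.exp (fluxConst α * (bigLam ε₀)⁻¹ * M + viscCoef ε₀ νh (b + N) σ₀) := by
  have hΛpos : 0 < bigLam ε₀ := bigLam_pos (by linarith)
  have hM0 : 0 ≤ M := le_trans (integral_nonneg fun _ => norm_nonneg _) (hM 0).2
  have hWc : ∀ n : ℤ, Continuous (W n) := fun n =>
    continuous_iff_continuousAt.2 fun x => (hW.law n x).continuousAt
  set c : ℝ := fluxConst α * (bigLam ε₀)⁻¹ * M + viscCoef ε₀ νh (b + N) σ₀ with hcdef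
  set Ssum : ℝ → ℝ := fun σ => ∑ j ∈ Finset.range (N + 1), ‖W (b + j) σ‖ with hSsum
  have hSsum0 : ∀ σ, 0 ≤ Ssum σ := fun σ => Finset.sum_nonneg fun j _ => norm_nonneg _
  set h : ℝ := ‖W (b + N) σ₀‖ with hhdef
  have hh0 : 0 ≤ h := norm_nonneg _
  have hΛN : 0 < bigLam ε₀ ^ N := pow_pos hΛpos N
  have hΛb : 0 < (bigLam ε₀ ^ b)⁻¹ ^ 2 := by
    have := zpow_pos hΛpos b
    positivity
  -- amplitude form: `Ssum σ ≥ Λ^{-N} h e^{-c} e^{σ₀-σ}`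
  have hamp : ∀ σ, σ₀ ≤ σ →
      (bigLam ε₀ ^ N)⁻¹ * h * Real.exp (-c) * Real.exp (σ₀ - σ) ≤ Ssum σ := by
    intro σ hσ
    have hEtop : physEnergy ε₀ W (b + N) σ₀ ≤
        ∑ j ∈ Finset.range (N + 1), physEnergy ε₀ W (b + j) σ₀ :=
      Finset.single_le_sum (s := Finset.range (N + 1))
        (f := fun j : ℕ => physEnergy ε₀ W (b + (j : ℤ)) σ₀)
        (fun j _ => physEnergy_nonneg _ _ _ _) (Finset.mem_range.2 (Nat.lt_succ_self N))
    have hp := hEtop.trans ((blockEnergy_persist hε hc hW hM b N σ₀ hF hσ).trans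
      (mul_le_mul_of_nonneg_right (blockEnergy_le_sq_sum hε W b N σ) (Real.exp_pos _).le))
    -- `hp : E_{b+N}(σ₀) ≤ Λ^{-2b} e^{2σ} Ssum(σ)² e^{2c}`
    have eE : physEnergy ε₀ W (b + N) σ₀
        = (bigLam ε₀ ^ b)⁻¹ ^ 2 * ((bigLam ε₀ ^ N)⁻¹ * (Real.exp σ₀ * h)) ^ 2 := by
      unfold physEnergy
      rw [show (2 : ℝ) * σ₀ = σ₀ + σ₀ by ring, Real.exp_add, zpow_add₀ hΛpos.ne', zpow_natCast,
        mul_inv]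
      ring
    have e2 : (bigLam ε₀ ^ b)⁻¹ ^ 2 * Real.exp (2 * σ) * Ssum σ ^ 2 * Real.exp (2 * c)
        = (bigLam ε₀ ^ b)⁻¹ ^ 2 * (Real.exp σ * Ssum σ * Real.exp c) ^ 2 := by
      rw [show (2 : ℝ) * σ = σ + σ by ring, show (2 : ℝ) * c = c + c by ring, Real.exp_add,
        Real.exp_add]
      ring
    rw [eE, e2] at hp
    have hsq := le_of_mul_le_mul_left hp hΛb
    have hpos : 0 ≤ Real.exp σ * Ssum σ * Real.exp c :=
      mul_nonneg (mul_nonneg (Real.exp_pos _).le (hSsum0 σ)) (Real.exp_pos _).le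
    have hposl : 0 ≤ (bigLam ε₀ ^ N)⁻¹ * (Real.exp σ₀ * h) :=
      mul_nonneg (inv_nonneg.2 hΛN.le) (mul_nonneg (Real.exp_pos _).le hh0)
    have hroot : (bigLam ε₀ ^ N)⁻¹ * (Real.exp σ₀ * h) ≤ Real.exp σ * Ssum σ * Real.exp c := by
      have := Real.sqrt_le_sqrt hsq
      rwa [Real.sqrt_sq hposl, Real.sqrt_sq hpos] at this
    have e3 : (bigLam ε₀ ^ N)⁻¹ * h * Real.exp (-c) * Real.exp (σ₀ - σ)
        = ((bigLam ε₀ ^ N)⁻¹ * (Real.exp σ₀ * h)) * (Real.exp (-c) * Real.exp (-σ)) := by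
      rw [show σ₀ - σ = σ₀ + -σ by ring, Real.exp_add]; ring
    have e4 : Ssum σ = (Real.exp σ * Ssum σ * Real.exp c) * (Real.exp (-c) * Real.exp (-σ)) := by
      have h5 : Real.exp σ * Real.exp (-σ) = 1 := by rw [← Real.exp_add]; simp
      have h6 : Real.exp c * Real.exp (-c) = 1 := by rw [← Real.exp_add]; simp
      calc Ssum σ = Ssum σ * (Real.exp σ * Real.exp (-σ)) * (Real.exp c * Real.exp (-c)) := by
            rw [h5, h6]; ring
        _ = _ := by ring
    rw [e3, e4]
    exact mul_le_mul_of_nonneg_right hroot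
      (mul_nonneg (Real.exp_pos _).le (Real.exp_pos _).le)
  -- integrate and let `L → ∞`
  have hSc : Continuous Ssum := by
    simp only [hSsum]
    exact continuous_finsetSum _ fun j _ => (hWc (b + j)).norm
  have hSint : ∀ L, 0 ≤ L → ∫ s in σ₀..(σ₀ + L), Ssum s ≤ (N + 1) * M := by
    intro L hL
    have hswap : ∫ s in σ₀..(σ₀ + L), Ssum s
        = ∑ j ∈ Finset.range (N + 1), ∫ s in σ₀..(σ₀ + L), ‖W (b + j) s‖ :=
      intervalIntegral.integral_finsetSum (fun j _ => (hWc (b + j)).norm.intervalIntegrable _ _)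
    rw [hswap]
    calc ∑ j ∈ Finset.range (N + 1), ∫ s in σ₀..(σ₀ + L), ‖W (b + ↑j) s‖
        ≤ ∑ _j ∈ Finset.range (N + 1), M := Finset.sum_le_sum fun j _ =>
          (intervalIntegral_le_integral (hM (b + j)).1 (fun _ => norm_nonneg _) (by linarith)).trans
            (hM (b + j)).2
      _ = (N + 1) * M := by simp [Finset.sum_const, Finset.card_range]
  have hfin : (bigLam ε₀ ^ N)⁻¹ * h * Real.exp (-c) ≤ (N + 1) * M :=
    le_of_integral_exp_tail hSc hamp hSint
  -- conclude
  have e6 : h = (bigLam ε₀ ^ N * Real.exp c) * ((bigLam ε₀ ^ N)⁻¹ * h * Real.exp (-c)) := by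
    have h6 : Real.exp c * Real.exp (-c) = 1 := by rw [← Real.exp_add]; simp
    have h7 : bigLam ε₀ ^ N * (bigLam ε₀ ^ N)⁻¹ = 1 := mul_inv_cancel₀ hΛN.ne'
    calc h = (bigLam ε₀ ^ N * (bigLam ε₀ ^ N)⁻¹) * (Real.exp c * Real.exp (-c)) * h := by
          rw [h6, h7]; ring
      _ = _ := by ring
  have hfac : 0 ≤ bigLam ε₀ ^ N * Real.exp c := mul_nonneg hΛN.le (Real.exp_pos _).le
  calc ‖W (b + N) σ₀‖ = h := rfl
    _ = (bigLam ε₀ ^ N * Real.exp c) * ((bigLam ε₀ ^ N)⁻¹ * h * Real.exp (-c)) := e6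
    _ ≤ (bigLam ε₀ ^ N * Real.exp c) * ((N + 1) * M) := mul_le_mul_of_nonneg_left hfin hfac
    _ = (N + 1) * bigLam ε₀ ^ N * M *
        Real.exp (fluxConst α * (bigLam ε₀)⁻¹ * M + viscCoef ε₀ νh (b + N) σ₀) := by
        rw [hcdef]; ring


/-- **UNIFORM BOUND FROM SYNDETIC FORWARD EDGES (inviscid).**  If an admissible inviscid eternal
solution of a cancelling table has, within distance `G` below EVERY shell `k`, an edge `b−1 → b`
(`k − G ≤ b ≤ k`) across which the energy flux is never negative, then it is `UniformBound`, with
constant `(G+1) Λ^G M e^{C_A M/Λ}`.  `G = 0` is `WakeRatchetPersistence.uniformBound_of_forwardCascade`;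
general `G` allows arbitrary backscatter inside windows of `G` shells.  Hence the crux
`AdmissibleEternalBound` (stmt-23197) can fail for inviscid solutions only through energy travelling
DOWN the lattice across unboundedly long stretches.  MODEL lattice only; nothing about NS.
[cite: Tao2016AveragedNS, §4 Lemma 4.1 (4.8)–(4.10) with (4.3), Thm. 4.2 (statement shape), §6.4; cell vocabulary (`IsEternal`, `UniformBound`, `physFlux`)] -/
theorem uniformBound_of_syndeticForwardEdges (hε : 0 < ε₀) (hc : IsCancellingCoeff α)
    (hW : IsEternal ε₀ α W) (G : ℕ)
    (hF : ∀ k : ℤ, ∃ b : ℤ, k - G ≤ b ∧ b ≤ k ∧ ∀ σ : ℝ, 0 ≤ physFlux ε₀ α W (b - 1) σ) :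
    UniformBound W := by
  have hWv : IsEternalVisc ε₀ 0 α W := hW.isEternalVisc
  obtain ⟨M, hM⟩ := hWv.action
  have hM0 : 0 ≤ M := le_trans (integral_nonneg fun _ => norm_nonneg _) (hM 0).2
  have hΛpos : 0 < bigLam ε₀ := bigLam_pos (by linarith)
  have hΛ1 : 1 ≤ bigLam ε₀ := one_le_bigLam hε.le
  refine ⟨(G + 1) * bigLam ε₀ ^ G * M * Real.exp (fluxConst α * (bigLam ε₀)⁻¹ * M), fun k σ => ?_⟩
  obtain ⟨b, hbk, hbk', hFb⟩ := hF k
  obtain ⟨N, hN⟩ : ∃ N : ℕ, k = b + N := ⟨(k - b).toNat, by rw [Int.toNat_of_nonneg (by linarith)]; ring⟩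
  have hNG : N ≤ G := by
    have : (N : ℤ) ≤ G := by linarith
    exact_mod_cast this
  have h := norm_le_of_forwardFlux_block hε hc hWv hM b N σ (fun s _ => hFb s)
  have hv : viscCoef ε₀ 0 (b + N) σ = 0 := by unfold viscCoef; ring
  rw [hv, add_zero, ← hN] at h
  refine h.trans ?_
  have h1 : (N : ℝ) + 1 ≤ G + 1 := by exact_mod_cast Nat.succ_le_succ hNG
  have h2 : bigLam ε₀ ^ N ≤ bigLam ε₀ ^ G := pow_le_pow_right₀ hΛ1 hNG
  have h3 : 0 ≤ Real.exp (fluxConst α * (bigLam ε₀)⁻¹ * M) := (Real.exp_pos _).le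
  have h4 : (N + 1) * bigLam ε₀ ^ N ≤ (G + 1) * bigLam ε₀ ^ G :=
    mul_le_mul h1 h2 (pow_pos hΛpos N).le (by positivity)
  exact mul_le_mul_of_nonneg_right (mul_le_mul_of_nonneg_right h4 hM0) h3

end Block

/-- **`AdmissibleEternalBound` HOLDS on the inviscid syndetic-forward-edge slice** (crux shape,
stmt-NavierStokesRegularity-23197; no threshold on `ε₀`); unbounded backscattering stretches and the
dissipation range `ν̂ > 0` are NOT settled here.  MODEL lattice only.
[cite: Tao2016AveragedNS, §4 Thm. 4.2 (statement shape), Lemma 4.1 (4.8)–(4.10), §6.4; cell vocabulary] -/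
theorem admissibleEternalBound_inviscid_syndeticForwardEdges (G : ℕ) :
    ∀ R : ℝ, 1 ≤ R → ∀ ε₀ : ℝ, 0 < ε₀ →
      ∀ α : Fin 4 → Fin 4 → Fin 4 → ℤ × ℤ × ℤ → ℝ, InTableClass R α →
        ∀ W : ℤ → ℝ → Em 4, IsEternal ε₀ α W →
          (∀ k : ℤ, ∃ b : ℤ, k - G ≤ b ∧ b ≤ k ∧ ∀ σ : ℝ, 0 ≤ physFlux ε₀ α W (b - 1) σ) →
          UniformBound W :=
  fun _R _hR _ε₀ hε₀ _α hα _W hW hF => uniformBound_of_syndeticForwardEdges hε₀ hα.2.1 hW G hF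

end WakeRatchetPersistenceBlock

end Summit.NavierStokesRegularity.NavierStokesRegularity.Theorems

end
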